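import Summits.QuantumFields.YangMills.Theorems.ColdStartUniversalityLatticeLangevinWilsonSemigroupPoincareSmoothing
import Summits.QuantumFields.YangMills.Theorems.ColdStartUniversalityUniformColdStartMixingOfChiSquare
import HarnessLib

/-!
# Route `ColdStartUniversality`, crux K_A1 `UniformColdStartMixing` (stmt-QuantumFields-24809), `L²` twin of line «cold_entropy»:
# THE CRUX FROM A K-UNIFORM POINCARÉ INEQUALITY FOR THE SEMIGROUP DIRICHLET FORM — `hEquiv` REMOVED

Helper file (seat `ym-line-csu-p1`, g17; `--supports stmt-QuantumFields-24809`).  g16 landed the `L²` pair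
`(H1) K-uniform L²(μ_K) gap in physical units → (H2) K-uniform cold-start χ² budget → UniformColdStartMixing`
(`UniformColdStartMixing_of_chiSquare`) and derived (H1) from a STATIC K-uniform Poincaré inequality modulo the classical
Poincaré ⇔ decay equivalence, taken as a hypothesis `hEquiv` (`UniformColdStartMixing_of_uniformPoincare`).  With the g17
semigroup-form Poincaré package (`…WilsonSemigroupConvexity/Poincare/PoincareSmoothing`) the hypothesis disappears or shrinks:

* ★★ `uniformL2Gap_of_uniformSemigroupPoincare` — a K-UNIFORM POINCARÉ INEQUALITY FOR THE SEMIGROUP DIRICHLET FORM in physical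
  units («for `K ≥ K₀`, every realising kernel family, every continuous `G` and every `η > 0` there is a lattice scale `h > 0` with
  `(c ε_K − η) Var_{μ_K}(G) ≤ h⁻¹(∫ G² dμ_K − ∫ G κ_h G dμ_K)`», i.e. `c ε_K · Var_K ≤ 𝓔_K = sup_h 𝓔_{K,h}` on `C(X)`) implies (H1)
  VERBATIM — UNCONDITIONALLY (`integral_sq_transition_sub_le_exp_of_semigroupPoincare` + the measurable bridge).
* ★★ `UniformColdStartMixing_of_uniformSemigroupPoincare` — hence (uniform semigroup-form Poincaré) → (H2) → THE CRUX BY NAME.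
* ★ `UniformColdStartMixing_of_uniformPoincare_of_smoothing` — the g16 statement with `hEquiv` replaced by the ONE regularity
  input it really needs: smoothing `(S)` of the SZZ kernels at each fixed `L, β'` (`κ_s C(X) ⊆ C³_c`-cylinders, `s > 0`).

Reading for the planner of record: the static hypothesis of the `L²` line may be stated directly on the semigroup Dirichlet form
(Bakry–Gentil–Ledoux Remark 4.3.3's form of `P(C)`), and then NO core / essential-self-adjointness / flow-regularity fact is owed;
if it is delivered in generator form on smooth cylinders (as a Bakry–Émery or multiscale argument would), exactly `(S)` is owed at
each fixed cut-off.  THEOREMS ONLY, no definition, no sorry.  HONEST FRAMING: bookkeeping; every K-uniform hypothesis here is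
OPEN (it is the crux in `L²` clothing); both (H1) and (H2) hold at each fixed cut-off; nothing K-uniform is proved; crux K_A1, rung R3
and the summit are NOT proved; the Yang–Mills mass gap is NOT proved.
-/

set_option autoImplicit false

noncomputable section

namespace Summit.QuantumFields.YangMills.Theorems.ColdStartUniversality

open MeasureTheory ProbabilityTheory
open scoped NNReal ENNReal
open Literature.Probability.Process Literature.MathematicalPhysics.QuantumFieldTheory
open Literature.MathematicalPhysics.QuantumLattice (fundamentalRep fundamentalLatticeRep continuous_fundamentalRep)
open Literature.MathematicalPhysics.QuantumFieldTheory.Balaban1983to89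

/-- ★★ **(H1) from a K-uniform Poincaré inequality for the SEMIGROUP Dirichlet form in physical units — no `hEquiv`.**
At each `K ≥ K₀` apply `integral_sq_transition_sub_le_exp_of_semigroupPoincare` with `λ = c ε_K` (continuous observables), then the
bridge `integral_sq_transition_sub_le_exp_of_measurable` to bounded measurable ones.
[cite: BakryGentilLedoux2014, Thm 4.2.5 with Remark 4.3.3] -/
theorem uniformL2Gap_of_uniformSemigroupPoincare :
    -- K-UNIFORM POINCARÉ INEQUALITY FOR THE SEMIGROUP DIRICHLET FORM OF THE SZZ DYNAMICS, IN PHYSICAL UNITS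
    (∃ γ₁ : ℝ, 0 < γ₁ ∧ ∀ (F : T3ContinuumYM3Torus.T3Family) (γ : ℝ), 0 < γ → γ ≤ γ₁ →
      ∃ c : ℝ, 0 < c ∧ ∃ K₀ : ℕ, ∀ K : ℕ, K₀ ≤ K →
        ∀ (κ : ℝ≥0 → Kernel (GaugeConfig 3 ((F.P K).sitesPerDir 0) (Matrix.specialUnitaryGroup (Fin 2) ℂ))
            (GaugeConfig 3 ((F.P K).sitesPerDir 0) (Matrix.specialUnitaryGroup (Fin 2) ℂ))) [∀ t, IsMarkovKernel (κ t)],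
          (∀ (t : ℝ≥0) (x : GaugeConfig 3 ((F.P K).sitesPerDir 0) (Matrix.specialUnitaryGroup (Fin 2) ℂ))
            (Ω : Type) [MeasurableSpace Ω] (P : Measure Ω) [IsProbabilityMeasure P]
            (W : ℝ≥0 → Ω → (Edge 3 ((F.P K).sitesPerDir 0) × NoiseIdx 2 → ℝ)) (hW : IsFlatBrownian W P)
            (U : ℝ≥0 → Ω → GaugeConfig 3 ((F.P K).sitesPerDir 0) (Matrix.specialUnitaryGroup (Fin 2) ℂ)),
            (∀ ω, U 0 ω = x) →
            (latticeLangevinDynamics (fundamentalLatticeRep 2) ((γ * (F.P K).eps)⁻¹ / 2)).IsSolution (fundamentalRep (Fin 2))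
              hW.natFiltration P W U →
            κ t x = P.map (U t)) →
          ∀ (G : GaugeConfig 3 ((F.P K).sitesPerDir 0) (Matrix.specialUnitaryGroup (Fin 2) ℂ) → ℝ), Continuous G →
            ∀ η : ℝ, 0 < η → ∃ h : ℝ≥0, 0 < h ∧
            (c * (F.P K).eps - η) * ∫ x, (G x - ∫ z, G z ∂(wilsonMeasure (d := 3) (L := (F.P K).sitesPerDir 0)
                (fundamentalRep (Fin 2)) ((γ * (F.P K).eps)⁻¹ / 2))) ^ 2
                ∂(wilsonMeasure (d := 3) (L := (F.P K).sitesPerDir 0) (fundamentalRep (Fin 2)) ((γ * (F.P K).eps)⁻¹ / 2)) ≤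
              (h : ℝ)⁻¹ * ((∫ x, G x * G x ∂(wilsonMeasure (d := 3) (L := (F.P K).sitesPerDir 0)
                  (fundamentalRep (Fin 2)) ((γ * (F.P K).eps)⁻¹ / 2))) -
                ∫ x, G x * (∫ y, G y ∂(κ h x)) ∂(wilsonMeasure (d := 3) (L := (F.P K).sitesPerDir 0)
                  (fundamentalRep (Fin 2)) ((γ * (F.P K).eps)⁻¹ / 2)))) →
    -- (H1) of `chiSquareStep`
    (∃ γ₁ : ℝ, 0 < γ₁ ∧ ∀ (F : T3ContinuumYM3Torus.T3Family) (γ : ℝ), 0 < γ → γ ≤ γ₁ →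
      ∃ c : ℝ, 0 < c ∧ ∃ K₀ : ℕ, ∀ K : ℕ, K₀ ≤ K →
        ∀ (κ : ℝ≥0 → Kernel (GaugeConfig 3 ((F.P K).sitesPerDir 0) (Matrix.specialUnitaryGroup (Fin 2) ℂ))
            (GaugeConfig 3 ((F.P K).sitesPerDir 0) (Matrix.specialUnitaryGroup (Fin 2) ℂ))) [∀ t, IsMarkovKernel (κ t)],
          (∀ (t : ℝ≥0) (x : GaugeConfig 3 ((F.P K).sitesPerDir 0) (Matrix.specialUnitaryGroup (Fin 2) ℂ))
            (Ω : Type) [MeasurableSpace Ω] (P : Measure Ω) [IsProbabilityMeasure P]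
            (W : ℝ≥0 → Ω → (Edge 3 ((F.P K).sitesPerDir 0) × NoiseIdx 2 → ℝ)) (hW : IsFlatBrownian W P)
            (U : ℝ≥0 → Ω → GaugeConfig 3 ((F.P K).sitesPerDir 0) (Matrix.specialUnitaryGroup (Fin 2) ℂ)),
            (∀ ω, U 0 ω = x) →
            (latticeLangevinDynamics (fundamentalLatticeRep 2) ((γ * (F.P K).eps)⁻¹ / 2)).IsSolution (fundamentalRep (Fin 2))
              hW.natFiltration P W U →
            κ t x = P.map (U t)) →
          ∀ (G : GaugeConfig 3 ((F.P K).sitesPerDir 0) (Matrix.specialUnitaryGroup (Fin 2) ℂ) → ℝ), Measurable G →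
            (∀ x, |G x| ≤ 1) → ∀ t : ℝ≥0,
            ∫ x, ((∫ y, G y ∂(κ t x)) - ∫ z, G z ∂(wilsonMeasure (d := 3) (L := (F.P K).sitesPerDir 0)
                (fundamentalRep (Fin 2)) ((γ * (F.P K).eps)⁻¹ / 2))) ^ 2
                ∂(wilsonMeasure (d := 3) (L := (F.P K).sitesPerDir 0) (fundamentalRep (Fin 2)) ((γ * (F.P K).eps)⁻¹ / 2)) ≤
              Real.exp (-2 * c * ((F.P K).eps * t)) *
                ∫ x, (G x - ∫ z, G z ∂(wilsonMeasure (d := 3) (L := (F.P K).sitesPerDir 0)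
                  (fundamentalRep (Fin 2)) ((γ * (F.P K).eps)⁻¹ / 2))) ^ 2
                  ∂(wilsonMeasure (d := 3) (L := (F.P K).sitesPerDir 0) (fundamentalRep (Fin 2)) ((γ * (F.P K).eps)⁻¹ / 2))) := by
  rintro ⟨γ₁, hγ₁, hP⟩
  refine ⟨γ₁, hγ₁, fun F γ hγ hγle => ?_⟩
  obtain ⟨c, hc, K₀, hK⟩ := hP F γ hγ hγle
  refine ⟨c, hc, K₀, fun K hKK κ _ hreal G hG hG1 t => ?_⟩
  have hcont : ∀ G' : GaugeConfig 3 ((F.P K).sitesPerDir 0) (Matrix.specialUnitaryGroup (Fin 2) ℂ) → ℝ, Continuous G' →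
      ∫ x, ((∫ y, G' y ∂(κ t x)) - ∫ z, G' z ∂(wilsonMeasure (d := 3) (L := (F.P K).sitesPerDir 0)
          (fundamentalRep (Fin 2)) ((γ * (F.P K).eps)⁻¹ / 2))) ^ 2
          ∂(wilsonMeasure (d := 3) (L := (F.P K).sitesPerDir 0) (fundamentalRep (Fin 2)) ((γ * (F.P K).eps)⁻¹ / 2)) ≤
        Real.exp (-2 * (c * (F.P K).eps) * t) *
          ∫ x, (G' x - ∫ z, G' z ∂(wilsonMeasure (d := 3) (L := (F.P K).sitesPerDir 0)
            (fundamentalRep (Fin 2)) ((γ * (F.P K).eps)⁻¹ / 2))) ^ 2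
            ∂(wilsonMeasure (d := 3) (L := (F.P K).sitesPerDir 0) (fundamentalRep (Fin 2)) ((γ * (F.P K).eps)⁻¹ / 2)) :=
    fun G' hG' => integral_sq_transition_sub_le_exp_of_semigroupPoincare ((F.P K).sitesPerDir 0) ((γ * (F.P K).eps)⁻¹ / 2)
      κ hreal (lam := c * (F.P K).eps) (hK K hKK κ hreal) hG' t
  have h := integral_sq_transition_sub_le_exp_of_measurable ((F.P K).sitesPerDir 0) ((γ * (F.P K).eps)⁻¹ / 2) κ hreal
    (c := c * (F.P K).eps) (t := t) hcont hG hG1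
  have e : Real.exp (-2 * (c * (F.P K).eps) * t) = Real.exp (-2 * c * ((F.P K).eps * t)) := by
    congr 1; ring
  rw [e] at h
  exact h

/-- ★★ **The crux `UniformColdStartMixing` from a K-uniform semigroup-form Poincaré inequality and a K-uniform cold-start χ²
budget** — `UniformColdStartMixing_of_chiSquare` (g16) fed by `uniformL2Gap_of_uniformSemigroupPoincare`; no core / `hEquiv`
hypothesis remains. [cite: RobertsRosenthal1997, Theorem 2.1] -/
theorem UniformColdStartMixing_of_uniformSemigroupPoincare :
    (∃ γ₁ : ℝ, 0 < γ₁ ∧ ∀ (F : T3ContinuumYM3Torus.T3Family) (γ : ℝ), 0 < γ → γ ≤ γ₁ →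
      ∃ c : ℝ, 0 < c ∧ ∃ K₀ : ℕ, ∀ K : ℕ, K₀ ≤ K →
        ∀ (κ : ℝ≥0 → Kernel (GaugeConfig 3 ((F.P K).sitesPerDir 0) (Matrix.specialUnitaryGroup (Fin 2) ℂ))
            (GaugeConfig 3 ((F.P K).sitesPerDir 0) (Matrix.specialUnitaryGroup (Fin 2) ℂ))) [∀ t, IsMarkovKernel (κ t)],
          (∀ (t : ℝ≥0) (x : GaugeConfig 3 ((F.P K).sitesPerDir 0) (Matrix.specialUnitaryGroup (Fin 2) ℂ))
            (Ω : Type) [MeasurableSpace Ω] (P : Measure Ω) [IsProbabilityMeasure P]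
            (W : ℝ≥0 → Ω → (Edge 3 ((F.P K).sitesPerDir 0) × NoiseIdx 2 → ℝ)) (hW : IsFlatBrownian W P)
            (U : ℝ≥0 → Ω → GaugeConfig 3 ((F.P K).sitesPerDir 0) (Matrix.specialUnitaryGroup (Fin 2) ℂ)),
            (∀ ω, U 0 ω = x) →
            (latticeLangevinDynamics (fundamentalLatticeRep 2) ((γ * (F.P K).eps)⁻¹ / 2)).IsSolution (fundamentalRep (Fin 2))
              hW.natFiltration P W U →
            κ t x = P.map (U t)) →
          ∀ (G : GaugeConfig 3 ((F.P K).sitesPerDir 0) (Matrix.specialUnitaryGroup (Fin 2) ℂ) → ℝ), Continuous G →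
            ∀ η : ℝ, 0 < η → ∃ h : ℝ≥0, 0 < h ∧
            (c * (F.P K).eps - η) * ∫ x, (G x - ∫ z, G z ∂(wilsonMeasure (d := 3) (L := (F.P K).sitesPerDir 0)
                (fundamentalRep (Fin 2)) ((γ * (F.P K).eps)⁻¹ / 2))) ^ 2
                ∂(wilsonMeasure (d := 3) (L := (F.P K).sitesPerDir 0) (fundamentalRep (Fin 2)) ((γ * (F.P K).eps)⁻¹ / 2)) ≤
              (h : ℝ)⁻¹ * ((∫ x, G x * G x ∂(wilsonMeasure (d := 3) (L := (F.P K).sitesPerDir 0)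
                  (fundamentalRep (Fin 2)) ((γ * (F.P K).eps)⁻¹ / 2))) -
                ∫ x, G x * (∫ y, G y ∂(κ h x)) ∂(wilsonMeasure (d := 3) (L := (F.P K).sitesPerDir 0)
                  (fundamentalRep (Fin 2)) ((γ * (F.P K).eps)⁻¹ / 2)))) →
    (∃ γ₁ : ℝ, 0 < γ₁ ∧ ∀ (F : T3ContinuumYM3Torus.T3Family) (γ : ℝ), 0 < γ → γ ≤ γ₁ →
      ∃ s₀ X₀ : ℝ, 0 < s₀ ∧ 0 ≤ X₀ ∧ ∃ K₀ : ℕ, ∀ K : ℕ, K₀ ≤ K →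
        ∀ (Ω : Type) (mΩ : MeasurableSpace Ω) (P : Measure Ω) (_ : IsProbabilityMeasure P)
          (W : ℝ≥0 → Ω → (Edge 3 ((F.P K).sitesPerDir 0) × NoiseIdx 2 → ℝ)) (hW : IsFlatBrownian W P)
          (U : ℝ≥0 → Ω → GaugeConfig 3 ((F.P K).sitesPerDir 0) (Matrix.specialUnitaryGroup (Fin 2) ℂ)),
          ((∀ ω, U 0 ω = fun _ => 1) ∧
            (latticeLangevinDynamics (⟨2, fundamentalRep (Fin 2), continuous_fundamentalRep _,
                Literature.MathematicalPhysics.QuantumLattice.fundamentalRep_injective _,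
                Literature.MathematicalPhysics.QuantumLattice.fundamentalRep_mem_unitaryGroup⟩ :
                LatticeRep (Matrix.specialUnitaryGroup (Fin 2) ℂ)) ((γ * (F.P K).eps)⁻¹ / 2)).IsSolution
              (fundamentalRep (Fin 2)) hW.natFiltration P W U) →
          ∀ (G : GaugeConfig 3 ((F.P K).sitesPerDir 0) (Matrix.specialUnitaryGroup (Fin 2) ℂ) → ℝ), Measurable G →
            (∀ x, |G x| ≤ 1) →
            ((∫ ω, G (U (s₀ / (F.P K).eps).toNNReal ω) ∂P) - ∫ z, G z ∂(wilsonMeasure (d := 3) (L := (F.P K).sitesPerDir 0)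
                (fundamentalRep (Fin 2)) ((γ * (F.P K).eps)⁻¹ / 2))) ^ 2 ≤
              X₀ * ∫ x, (G x - ∫ z, G z ∂(wilsonMeasure (d := 3) (L := (F.P K).sitesPerDir 0)
                (fundamentalRep (Fin 2)) ((γ * (F.P K).eps)⁻¹ / 2))) ^ 2
                ∂(wilsonMeasure (d := 3) (L := (F.P K).sitesPerDir 0) (fundamentalRep (Fin 2)) ((γ * (F.P K).eps)⁻¹ / 2))) →
    Summit.QuantumFields.YangMills.Theses.ColdStartUniversality.UniformColdStartMixing :=
  fun h1 h2 => UniformColdStartMixing_of_chiSquare (uniformL2Gap_of_uniformSemigroupPoincare h1) h2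

/-- ★ **The g16 statement with `hEquiv` replaced by smoothing**: if at every `L, β'` the SZZ kernels smooth continuous
observables into `C³` compactly supported cylinder functions (`(S)`, hypoelliptic regularity — the one input not in the tree), then
a K-uniform STATIC (generator-form) Poincaré inequality in physical units and a K-uniform cold-start χ² budget imply the crux
(`integral_sq_transition_sub_le_exp_of_generatorPoincare_of_smoothing` discharges `hEquiv` of `UniformColdStartMixing_of_uniformPoincare`).
[cite: BakryGentilLedoux2014, Thm 4.2.5 and §3.2] -/
theorem UniformColdStartMixing_of_uniformPoincare_of_smoothing
    (hS : ∀ (L : ℕ) [NeZero L] (β' : ℝ)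
      (κ : ℝ≥0 → Kernel (GaugeConfig 3 L (Matrix.specialUnitaryGroup (Fin 2) ℂ))
        (GaugeConfig 3 L (Matrix.specialUnitaryGroup (Fin 2) ℂ))) [∀ t, IsMarkovKernel (κ t)],
      (∀ (t : ℝ≥0) (x : GaugeConfig 3 L (Matrix.specialUnitaryGroup (Fin 2) ℂ))
        (Ω : Type) [MeasurableSpace Ω] (P : Measure Ω) [IsProbabilityMeasure P]
        (W : ℝ≥0 → Ω → (Edge 3 L × NoiseIdx 2 → ℝ)) (hW : IsFlatBrownian W P)
        (U : ℝ≥0 → Ω → GaugeConfig 3 L (Matrix.specialUnitaryGroup (Fin 2) ℂ)),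
        (∀ ω, U 0 ω = x) →
        (latticeLangevinDynamics (fundamentalLatticeRep 2) β').IsSolution (fundamentalRep (Fin 2))
          hW.natFiltration P W U →
        κ t x = P.map (U t)) →
      ∀ s : ℝ≥0, 0 < s → ∀ H : GaugeConfig 3 L (Matrix.specialUnitaryGroup (Fin 2) ℂ) → ℝ, Continuous H →
      let coords : GaugeConfig 3 L (Matrix.specialUnitaryGroup (Fin 2) ℂ) → (Edge 3 L × Fin 2 × Fin 2 × Bool → ℝ) :=
        fun V q => (fun z : ℂ => if q.2.2.2 then z.im else z.re)
          ((fundamentalRep (Fin 2) (V q.1) : Matrix (Fin 2) (Fin 2) ℂ) q.2.1 q.2.2.1)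
      ∃ f : (Edge 3 L × Fin 2 × Fin 2 × Bool → ℝ) → ℝ, ContDiff ℝ 3 f ∧ HasCompactSupport f ∧
        ∀ V, ∫ y, H y ∂(κ s V) = f (coords V)) :
    (∃ γ₁ : ℝ, 0 < γ₁ ∧ ∀ (F : T3ContinuumYM3Torus.T3Family) (γ : ℝ), 0 < γ → γ ≤ γ₁ →
      ∃ c : ℝ, 0 < c ∧ ∃ K₀ : ℕ, ∀ K : ℕ, K₀ ≤ K →
        ∀ (f : (Edge 3 ((F.P K).sitesPerDir 0) × Fin 2 × Fin 2 × Bool → ℝ) → ℝ), ContDiff ℝ 3 f →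
        let coords : GaugeConfig 3 ((F.P K).sitesPerDir 0) (Matrix.specialUnitaryGroup (Fin 2) ℂ) →
            (Edge 3 ((F.P K).sitesPerDir 0) × Fin 2 × Fin 2 × Bool → ℝ) :=
          fun V q => (fun z : ℂ => if q.2.2.2 then z.im else z.re)
            ((fundamentalRep (Fin 2) (V q.1) : Matrix (Fin 2) (Fin 2) ℂ) q.2.1 q.2.2.1)
        let gen : GaugeConfig 3 ((F.P K).sitesPerDir 0) (Matrix.specialUnitaryGroup (Fin 2) ℂ) → ℝ := fun V =>
          (∑ i : Edge 3 ((F.P K).sitesPerDir 0) × Fin 2 × Fin 2 × Bool, fderiv ℝ f (coords V) (Pi.single i 1) *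
              (fun z : ℂ => if i.2.2.2 then z.im else z.re)
                ((latticeLangevinDynamics (fundamentalLatticeRep 2) ((γ * (F.P K).eps)⁻¹ / 2)).drift
                  (matrixConfig (fundamentalRep (Fin 2)) V) i.1 i.2.1 i.2.2.1) +
          1 / 2 * ∑ i : Edge 3 ((F.P K).sitesPerDir 0) × Fin 2 × Fin 2 × Bool,
            ∑ j : Edge 3 ((F.P K).sitesPerDir 0) × Fin 2 × Fin 2 × Bool,
            fderiv ℝ (fun z => fderiv ℝ f z (Pi.single i 1)) (coords V) (Pi.single j 1) *
              ∑ n : Edge 3 ((F.P K).sitesPerDir 0) × NoiseIdx 2,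
                (if n.1 = i.1 then (fun z : ℂ => if i.2.2.2 then z.im else z.re)
                  ((latticeLangevinDynamics (fundamentalLatticeRep 2) ((γ * (F.P K).eps)⁻¹ / 2)).noise
                    (matrixConfig (fundamentalRep (Fin 2)) V) i.1 n.2 i.2.1 i.2.2.1) else 0) *
                (if n.1 = j.1 then (fun z : ℂ => if j.2.2.2 then z.im else z.re)
                  ((latticeLangevinDynamics (fundamentalLatticeRep 2) ((γ * (F.P K).eps)⁻¹ / 2)).noise
                    (matrixConfig (fundamentalRep (Fin 2)) V) j.1 n.2 j.2.1 j.2.2.1) else 0))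
        c * (F.P K).eps * ∫ V, (f (coords V) - ∫ V', f (coords V')
            ∂(wilsonMeasure (d := 3) (L := (F.P K).sitesPerDir 0) (fundamentalRep (Fin 2)) ((γ * (F.P K).eps)⁻¹ / 2))) ^ 2
            ∂(wilsonMeasure (d := 3) (L := (F.P K).sitesPerDir 0) (fundamentalRep (Fin 2)) ((γ * (F.P K).eps)⁻¹ / 2)) ≤
          -∫ V, (f (coords V) - ∫ V', f (coords V')
            ∂(wilsonMeasure (d := 3) (L := (F.P K).sitesPerDir 0) (fundamentalRep (Fin 2)) ((γ * (F.P K).eps)⁻¹ / 2))) *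
            gen V ∂(wilsonMeasure (d := 3) (L := (F.P K).sitesPerDir 0) (fundamentalRep (Fin 2)) ((γ * (F.P K).eps)⁻¹ / 2))) →
    (∃ γ₁ : ℝ, 0 < γ₁ ∧ ∀ (F : T3ContinuumYM3Torus.T3Family) (γ : ℝ), 0 < γ → γ ≤ γ₁ →
      ∃ s₀ X₀ : ℝ, 0 < s₀ ∧ 0 ≤ X₀ ∧ ∃ K₀ : ℕ, ∀ K : ℕ, K₀ ≤ K →
        ∀ (Ω : Type) (mΩ : MeasurableSpace Ω) (P : Measure Ω) (_ : IsProbabilityMeasure P)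
          (W : ℝ≥0 → Ω → (Edge 3 ((F.P K).sitesPerDir 0) × NoiseIdx 2 → ℝ)) (hW : IsFlatBrownian W P)
          (U : ℝ≥0 → Ω → GaugeConfig 3 ((F.P K).sitesPerDir 0) (Matrix.specialUnitaryGroup (Fin 2) ℂ)),
          ((∀ ω, U 0 ω = fun _ => 1) ∧
            (latticeLangevinDynamics (⟨2, fundamentalRep (Fin 2), continuous_fundamentalRep _,
                Literature.MathematicalPhysics.QuantumLattice.fundamentalRep_injective _,
                Literature.MathematicalPhysics.QuantumLattice.fundamentalRep_mem_unitaryGroup⟩ :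
                LatticeRep (Matrix.specialUnitaryGroup (Fin 2) ℂ)) ((γ * (F.P K).eps)⁻¹ / 2)).IsSolution
              (fundamentalRep (Fin 2)) hW.natFiltration P W U) →
          ∀ (G : GaugeConfig 3 ((F.P K).sitesPerDir 0) (Matrix.specialUnitaryGroup (Fin 2) ℂ) → ℝ), Measurable G →
            (∀ x, |G x| ≤ 1) →
            ((∫ ω, G (U (s₀ / (F.P K).eps).toNNReal ω) ∂P) - ∫ z, G z ∂(wilsonMeasure (d := 3) (L := (F.P K).sitesPerDir 0)
                (fundamentalRep (Fin 2)) ((γ * (F.P K).eps)⁻¹ / 2))) ^ 2 ≤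
              X₀ * ∫ x, (G x - ∫ z, G z ∂(wilsonMeasure (d := 3) (L := (F.P K).sitesPerDir 0)
                (fundamentalRep (Fin 2)) ((γ * (F.P K).eps)⁻¹ / 2))) ^ 2
                ∂(wilsonMeasure (d := 3) (L := (F.P K).sitesPerDir 0) (fundamentalRep (Fin 2)) ((γ * (F.P K).eps)⁻¹ / 2))) →
    Summit.QuantumFields.YangMills.Theses.ColdStartUniversality.UniformColdStartMixing :=
  fun hP h2 => UniformColdStartMixing_of_uniformPoincare
    (fun L _ β' _ _ hPgen κ _ hreal _ hG t =>
      integral_sq_transition_sub_le_exp_of_generatorPoincare_of_smoothing L β' κ hreal (hS L β' κ hreal) hPgen hG t) hP h2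

end Summit.QuantumFields.YangMills.Theorems.ColdStartUniversality

end
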